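import Summits.HodgeConjecture.HodgeConjecture.Theorems.Ring2HypothesesDescentMotivatedPullback
import Summits.HodgeConjecture.HodgeConjecture.Theorems.Ring2HypothesesDescentMotivatedUpperHalf
import Literature.AlgebraicGeometry.Motives.AbelianVarietyExistence
import Literature.AlgebraicGeometry.Motives.AbelianVarietyProductDimProofs
import HarnessLib

/-!
# Ring 2 hypotheses, descent face — motivated classes are stable under ALGEBRAIC CORRESPONDENCES (real
# carriers); row b05 is its LOWER half, and is the MIDDLE degree of even-dimensional abelian varieties

research route conditional on HC_CM; not a corollary; Q11.4-sentence-2 already refuted in dim ≥ 3.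
Cell `pub-hodge-ring2` (Hodge ladder STAGE 3), seat `ring2-b05` (binder row b05
`Ring2.Hypotheses.MotivatedImpliesAlgebraicAV`), gen 34. `HC_CM` (`Theses.RankFourFaces.CMAbelianHodge`) does not
occur in this file; nothing here proves a case of the Hodge conjecture; row b05 stays OPEN and is NOT asserted.

With André's Prop. 2.1 (ii), first inclusion, now a theorem on the real carriers
(`Theorems.map_snd_mem_motivatedClasses`, file `Ring2HypothesesDescentMotivatedPullback`, gen 34), the Corollaire
of Prop. 2.1 (p. 15: "les correspondances motivées se composent"; here only the algebraic ones are needed) follows: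

* §1 `corrClassAction_mem_motivatedClasses` — **`γ^*(A_motᵖ(X)_ℂ) ⊆ A_mot^{p'}(W)_ℂ` for `γ` ALGEBRAIC on `W ⊗ X`**
  (`γ^* c = pr_{W*}(pr_X^* c ∪ γ)`: pull-back `map_snd_mem_motivatedClasses`, "motivated ∪ algebraic is motivated"
  `cupProduct_mem_motivatedClasses_of_cupProduct_algebraic` fed with the PROVED multiplicativity
  `Voisin2003_cupProduct_algebraicClasses_holds`, push-forward `gysinMap_fst_mem_motivatedClasses`);
  `map_mem_motivatedClasses_of_isAlgebraicCorrespondence` — any map induced by an algebraic correspondence preserves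
  motivated classes; `complexGysin_mem_motivatedClasses` — so does `f_*` for every morphism `f`.
* §2 `motivatedClasses_le_algebraicClasses_abelianVariety_of_lower` — on a complex abelian variety (`*_L` algebraic,
  Lieberman; the AbelianAll sub-cell's `standardConjectureBStar_abelianVariety`) `A_motᵖ(A) ⊆ Nᵖ(A)` in codimension
  `p` implies the same in codimension `g - p ≥ p` — the direction gen 33 (`…MotivatedUpperHalf`) could NOT claim;
  `motivatedImpliesAlgebraicAV_iff_lowerHalf` — **row b05 is its lower half** (codimensions `2 ≤ p ≤ g/2`);
  `motivatedDefect_eq_abelianVariety` is not attempted (rank bookkeeping), only the inclusions.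
* §3 `motivatedClasses_le_algebraicClasses_of_prod_middleDegree` — the PRODUCT STEP of BFNP Lemma 48 for motivated
  classes inside abelian varieties (ab-spread-1's `mem_algebraicClasses_of_prod_middleDegree` with "rational `(p,p)`"
  replaced by "motivated": for `dim A = 2p + r`, `dim B = r`, the slice Gysin image `s_! c ∈ A_mot^{p+r}(A × B)` of a
  motivated `c` (`complexGysin_mem_motivatedClasses`) sits in the MIDDLE degree of the `2(p+r)`-fold `A × B`, and
  `c = pr_{1!} s_! c`); **`motivatedImpliesAlgebraicAV_iff_forall_middleDegree` — row b05 ⟺ on every complex abelian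
  variety of EVEN dimension `2m ≥ 4` the motivated classes of the middle codimension `m` are algebraic.**

No definition, no new named fact, no sorry; `MotivatedImpliesAlgebraicAV` appears only inside `↔`.

References: Andre1996Motifs (§2.1 Prop. 2.1 and Corollaire, pp. 14–15; §6.2 p. 31), Lieberman1968,
Kleiman1968AlgebraicCycles (App. to §2, Thm. 2A11), BrosnanFangNiePearlstein2009 (§6 Lemma 48),
VoisinHodgeII2003 (§9.2.4 Prop. 9.20–9.21), FultonYoungTableaux1997 (App. B §B.1 (2), (5), (6)).
-/

noncomputable section

set_option linter.dupNamespace false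

open CategoryTheory AlgebraicGeometry MonoidalCategory CartesianMonoidalCategory
open Literature.AlgebraicTopology.SingularHomology Literature.Geometry.Kaehler
open Literature.AlgebraicGeometry Literature.AlgebraicGeometry.Motives
open Literature.AlgebraicGeometry.HodgeTheory
open Summit.HodgeConjecture.HodgeConjecture.Theorems
open Summit.HodgeConjecture.HodgeConjecture.Ring2.AbelianAll (standardConjectureBStar_abelianVariety
  map_mem_algebraicClasses_of_isAlgebraicCorrespondence)

namespace Summit.HodgeConjecture.HodgeConjecture.Ring2.Hypotheses

/-! ## §1 Algebraic correspondences preserve motivated classes -/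

section Correspondences

variable {m n : ℕ} {W X : SchemeOver ℂ}

/-- **`γ^*(A_motᵖ(X)_ℂ) ⊆ A_mot^{p'}(W)_ℂ` for an algebraic class `γ ∈ Nᵉ H²ᵉ((W ⊗ X)(ℂ); ℂ)`** (André 1996, Prop. 2.1
and its Corollaire, p. 15, for ALGEBRAIC correspondences): `γ^* c = pr_{W*}(pr_X^* c ∪ γ)` (`corrClassAction`, any
orientations with Poincaré duality) with `pr_X^* c` motivated (Prop. 2.1 (ii), first inclusion —
`Theorems.map_snd_mem_motivatedClasses`), `· ∪ γ` motivated (`cupProduct_mem_motivatedClasses_of_cupProduct_algebraic`,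
the multiplicativity of algebraic classes being the theorem `Voisin2003_cupProduct_algebraicClasses_holds`) and `pr_{W*}`
preserving motivated classes (Prop. 2.1 (ii), second inclusion, `gysinMap_fst_mem_motivatedClasses`). Degrees:
`2p + 2e = 2p' + 2n`, `2p' + 2q = 2m`. [cite: Andre1996Motifs, Prop. 2.1 and Corollaire (pp. 14–15)]
[cite: VoisinHodgeII2003, §9.2.4 Prop. 9.20–9.21] -/
theorem corrClassAction_mem_motivatedClasses (hW : IsSmoothProjective m W) (hX : IsSmoothProjective n X)
    (μ : HomologicalOrientation ℂ (ComplexPoints (W ⊗ X)) (2 * (m + n)))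
    (ν : HomologicalOrientation ℂ (ComplexPoints W) (2 * m)) (hμ : μ.HasPoincareDuality) (hν : ν.HasPoincareDuality)
    {e p p' q : ℕ} (hab : 2 * p + 2 * e = 2 * p' + 2 * n) (hq : 2 * p' + 2 * q = 2 * m)
    {γ : complexBetti (W ⊗ X) (2 * e)} (hγ : γ ∈ algebraicClasses (W ⊗ X) e) {c : complexBetti X (2 * p)}
    (hc : c ∈ motivatedClasses n X p) : corrClassAction μ ν hab hq γ c ∈ motivatedClasses m W p' := by
  have hWX : IsSmoothProjective (m + n) (W ⊗ X) := IsSmoothProjective.tensor_holds hW hX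
  rw [corrClassAction_apply]
  have hsnd : complexBetti.map (snd W X) (2 * p) c ∈ motivatedClasses (m + n) (W ⊗ X) p :=
    map_snd_mem_motivatedClasses hX hW p hc
  have hcupm : ∀ (k : ℕ) (_ : p + e = k) (h2 : 2 * p + 2 * e = 2 * k),
      cupProduct h2 (complexBetti.map (snd W X) (2 * p) c) γ ∈ motivatedClasses (m + n) (W ⊗ X) k := by
    rintro k rfl h2
    exact cupProduct_mem_motivatedClasses_of_cupProduct_algebraic Voisin2003_cupProduct_algebraicClasses_holds hWX
      h2 hsnd hγ
  have hk := hcupm (p' + n) (by omega) (by omega)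
  -- degree bookkeeping `2p + 2e = 2(p' + n)`
  have key : ∀ {D : ℕ} (hD : 2 * p + 2 * e = D) (e1 : D + 2 * q = 2 * (m + n)),
      gysinMap μ ν (AlgPoints.mapContinuous (L := ℂ) (fst W X)) e1 hq
          (cupProduct hD (complexBetti.map (snd W X) (2 * p) c) γ) =
        gysinMap μ ν (AlgPoints.mapContinuous (L := ℂ) (fst W X))
          (show 2 * p + 2 * e + 2 * q = 2 * (m + n) by omega) hq
          (cupProduct rfl (complexBetti.map (snd W X) (2 * p) c) γ) := by
    rintro D rfl e1
    rfl
  rw [← key (show 2 * p + 2 * e = 2 * (p' + n) by omega) (show 2 * (p' + n) + 2 * q = 2 * (m + n) by omega)]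
  exact gysinMap_fst_mem_motivatedClasses hW hX μ ν hμ hν _ hq hk

/-- **Maps induced by algebraic correspondences preserve motivated classes**: if
`T : H²ᵖ(X(ℂ); ℂ) → H^{2p'}(W(ℂ); ℂ)` is induced by an algebraic correspondence (`IsAlgebraicCorrespondence m n W X T`),
then `T(A_motᵖ(X)_ℂ) ⊆ A_mot^{p'}(W)_ℂ` (unpack the correspondence and apply `corrClassAction_mem_motivatedClasses`; the
homological degree `q` of the correspondence is even, `2p' + q = 2m`).
[cite: Andre1996Motifs, Prop. 2.1 and Corollaire (pp. 14–15)] -/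
theorem map_mem_motivatedClasses_of_isAlgebraicCorrespondence (hW : IsSmoothProjective m W)
    (hX : IsSmoothProjective n X) {p p' : ℕ} {T : complexBetti X (2 * p) →ₗ[ℂ] complexBetti W (2 * p')}
    (hT : IsAlgebraicCorrespondence m n W X T) {c : complexBetti X (2 * p)} (hc : c ∈ motivatedClasses n X p) :
    T c ∈ motivatedClasses m W p' := by
  obtain ⟨μ, ν, hμ, hν, e, q, hab, hq, γ, hγ, hTeq⟩ := hT
  rw [← hTeq]
  obtain ⟨q', rfl⟩ : ∃ q', q = 2 * q' := ⟨m - p', by omega⟩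
  exact corrClassAction_mem_motivatedClasses hW hX μ ν hμ hν hab hq hγ hc

/-- **`f_*(A_motᵖ(X')_ℂ) ⊆ A_mot^{p'}(X)_ℂ` for every morphism `f : X' ⟶ X`** of smooth projective complex varieties
(dimensions `m`, `n`; `2p + 2n = 2p' + 2m`): the Gysin morphism `complexGysin μ` of any orientation family is induced
by the transposed graph (`isAlgebraicCorrespondence_complexGysin`), an algebraic correspondence (André p. 15: "en
composant … avec la classe du graphe de `f` ou sa transposée"). [cite: Andre1996Motifs, §2.1 (p. 15)]
[cite: FultonYoungTableaux1997, Appendix B §B.1 (5)] -/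
theorem complexGysin_mem_motivatedClasses (μ : OrientationFamily) {X' : SchemeOver ℂ}
    (hX' : IsSmoothProjective m X') (hX : IsSmoothProjective n X) (f : X' ⟶ X) {p p' : ℕ}
    (hab : 2 * p + 2 * n = 2 * p' + 2 * m) (hp' : p' ≤ n) {c : complexBetti X' (2 * p)}
    (hc : c ∈ motivatedClasses m X' p) : complexGysin μ hX' hX f hab c ∈ motivatedClasses n X p' :=
  map_mem_motivatedClasses_of_isAlgebraicCorrespondence hX hX'
    (isAlgebraicCorrespondence_complexGysin μ (OrientationFamily.hasPoincareDuality μ) hX' hX f hab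
      (show 2 * p' + (2 * n - 2 * p') = 2 * n by omega)) hc

end Correspondences

/-! ## §2 Abelian varieties: `*_L` preserves motivated classes; row b05 is its lower half -/

section Abelian

/-- **On a complex abelian variety `A` of dimension `g`, `2p + j = g`: `A_motᵖ(A) ⊆ Nᵖ(A) ⟹ A_mot^{p+j}(A) ⊆ N^{p+j}(A)`**
(lower codimension ⟹ complementary upper codimension), unconditionally: for `y ∈ A_mot^{p+j}`, `*_L y ∈ H²ᵖ` is motivated
(`*_L` is an algebraic correspondence on an abelian variety — Lieberman, the AbelianAll sub-cell's
`standardConjectureBStar_abelianVariety` — and §1), hence algebraic by hypothesis, and `y = Lʲ(*_L y)` is algebraic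
(`N¹ ∪ Nᵖ ⊆ Nᵖ⁺¹`). The converse direction is gen 33's `motivatedClasses_le_algebraicClasses_abelianVariety_of_upper`.
[cite: Lieberman1968, main theorem] [cite: Kleiman1968AlgebraicCycles, Appendix to §2, Thm. 2A11]
[cite: Andre1996Motifs, §2.1 (p. 14) and §6.2 (p. 31)] -/
theorem motivatedClasses_le_algebraicClasses_abelianVariety_of_lower (A : AbelianVariety ℂ) {p j : ℕ}
    (hj : 2 * p + j = A.dim) (hlow : motivatedClasses A.dim A.X p ≤ algebraicClasses A.X p) :
    motivatedClasses A.dim A.X (p + j) ≤ algebraicClasses A.X (p + j) := by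
  have hA : IsSmoothProjective A.dim A.X := AbelianVariety.isSmoothProjective_holds (A := A)
  obtain ⟨Λ⟩ := nonempty_hardLefschetzNFold_holds A.dim A.X hA
  have hη := Λ.isPolarizationClass
  have hab : 2 * (p + j) + 2 * p = 2 * A.dim := by omega
  have hB : IsAlgebraicCorrespondence A.dim A.dim A.X A.X (lefschetzInvolution hη.hasHardLefschetz hab) :=
    standardConjectureBStar_abelianVariety A Λ.hyperplaneClass hη _ _ hab
  intro y hy
  -- `x = *_L y` is motivated, hence algebraic
  have hx : lefschetzInvolution hη.hasHardLefschetz hab y ∈ algebraicClasses A.X p :=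
    hlow (map_mem_motivatedClasses_of_isAlgebraicCorrespondence hA hA hB hy)
  -- `y = Lʲ x`
  have hLx : ∀ (m : ℕ) (hm : 2 * p + 2 * j = m) (hab' : m + 2 * p = 2 * A.dim) (y' : complexBetti A.X m),
      lefschetzPowTo Λ.hyperplaneClass j (2 * p) m hm (lefschetzInvolution hη.hasHardLefschetz hab' y') = y' := by
    rintro m rfl hab' y'
    exact lefschetzPow_lefschetzInvolution hη.hasHardLefschetz (by omega) hab' y'
  rw [← hLx (2 * (p + j)) (by omega) hab y]
  exact lefschetzPowTo_mem_algebraicClasses_of_cupProduct Voisin2003_cupProduct_algebraicClasses_holds hA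
    hη.mem_algebraicClasses j p (by omega) hx

/-- **ROW b05 IS ITS LOWER HALF**: `MotivatedImpliesAlgebraicAV ⟺` on every complex abelian variety `A` the motivated
classes of codimension `p` with `2 ≤ p`, `2p ≤ dim A` are algebraic (gen 33's upper half
`motivatedImpliesAlgebraicAV_iff_upperHalf`, reflected through `*_L` by
`motivatedClasses_le_algebraicClasses_abelianVariety_of_lower`). Fact-free; row b05 itself is NOT asserted.
[cite: Andre1996Motifs, Thm. 0.6.2 (p. 9), §2.1 (p. 14), §6.2 (p. 31)] [cite: Lieberman1968, main theorem] -/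
theorem motivatedImpliesAlgebraicAV_iff_lowerHalf :
    MotivatedImpliesAlgebraicAV ↔
      ∀ (A : AbelianVariety ℂ) (p : ℕ), 2 ≤ p → 2 * p ≤ A.dim →
        motivatedClasses A.dim A.X p ≤ algebraicClasses A.X p := by
  refine ⟨fun h A p _ _ ↦ h A p, fun h ↦ motivatedImpliesAlgebraicAV_iff_upperHalf.2 fun A p hup hp2 ↦ ?_⟩
  obtain ⟨j, hj⟩ : ∃ j, A.dim + j = 2 * p := ⟨2 * p - A.dim, by omega⟩
  obtain ⟨p₀, hp₀⟩ : ∃ p₀, p₀ + j = p := ⟨p - j, by omega⟩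
  rw [← hp₀]
  exact motivatedClasses_le_algebraicClasses_abelianVariety_of_lower A (by omega) (h A p₀ (by omega) (by omega))

end Abelian

/-! ## §3 The product step for motivated classes; row b05 is the middle degree of even-dimensional abelian varieties -/

section Middle

/-- **The product step of BFNP Lemma 48 for motivated classes, inside abelian varieties.** Let `A`, `B` be complex
abelian varieties with `dim A = 2p + r`, `dim B = r`, and suppose the motivated classes of the MIDDLE codimension
`p + r` of the `2(p+r)`-fold `A × B` are algebraic. Then `A_motᵖ(A)_ℂ ⊆ Nᵖ(A)`: for the slice
`s = (𝟙, 0) : A ⟶ A × B`, `s_! c` is motivated (`complexGysin_mem_motivatedClasses`, §1), hence algebraic, and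
`c = (s ≫ pr₁)_! c = pr_{1!}(s_! c)` (`gysinMap_comp`, `gysinMap_id`) is algebraic
(`gysinMap_mem_algebraicClasses_of_isSmoothProjective`) — ab-spread-1's `mem_algebraicClasses_of_prod_middleDegree`
with "rational `(p,p)`" replaced by "motivated", no Hodge-type bookkeeping needed.
[cite: BrosnanFangNiePearlstein2009, §6 Lemma 48] [cite: FultonYoungTableaux1997, Appendix B §B.1 (2), (5)]
[cite: Andre1996Motifs, §2.1 (p. 15)] -/
theorem motivatedClasses_le_algebraicClasses_of_prod_middleDegree (A B : AbelianVariety ℂ) {p r : ℕ}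
    (hr : 2 * p + r = A.dim) (hB : B.dim = r)
    (hmid : motivatedClasses (A.dim + r) (A.X ⊗ B.X) (p + r) ≤ algebraicClasses (A.X ⊗ B.X) (p + r)) :
    motivatedClasses A.dim A.X p ≤ algebraicClasses A.X p := by
  intro c hc
  let μ : OrientationFamily := fun _ _ h ↦ (ComplexPoints.isOrientableOver ℂ h).some
  have hμ : μ.HasPoincareDuality := OrientationFamily.hasPoincareDuality μ
  have hX : IsSmoothProjective A.dim A.X := AbelianVariety.isSmoothProjective_holds
  have hP : IsSmoothProjective r B.X := hB ▸ AbelianVariety.isSmoothProjective_holds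
  have hXP : IsSmoothProjective (A.dim + r) (A.X ⊗ B.X) := IsSmoothProjective.tensor_holds hX hP
  have hab : 2 * p + 2 * (A.dim + r) = 2 * (p + r) + 2 * A.dim := by omega
  -- `c' := s_! c` is motivated, in the middle degree of `A × B`, hence algebraic
  have hc'alg : complexGysin μ hX hXP (sliceAt A.X (1 : B.Points ℂ)) hab c ∈ algebraicClasses (A.X ⊗ B.X) (p + r) :=
    hmid (complexGysin_mem_motivatedClasses μ hX hXP (sliceAt A.X (1 : B.Points ℂ)) hab (by omega) hc)
  -- `c = (s ≫ pr₁)_! c = pr_{1!} (s_! c)`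
  have hcc : gysinMap (μ hXP) (μ hX) (AlgPoints.mapContinuous (L := ℂ) (fst A.X B.X))
      (show 2 * (p + r) + (2 * A.dim - 2 * p) = 2 * (A.dim + r) by omega)
      (show 2 * p + (2 * A.dim - 2 * p) = 2 * A.dim by omega)
      (complexGysin μ hX hXP (sliceAt A.X (1 : B.Points ℂ)) hab c) = c := by
    rw [complexGysin_eq_gysinMap hX hXP (sliceAt A.X (1 : B.Points ℂ)) _ (q := 2 * A.dim - 2 * p)
        (by omega) (by omega),
      ← LinearMap.comp_apply, ← gysinMap_comp (hμ hXP), ← AlgPoints.mapContinuous_comp,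
      sliceAt_fst, AlgPoints.mapContinuous_id, gysinMap_id (hμ hX), LinearMap.id_apply]
  rw [← hcc]
  exact gysinMap_mem_algebraicClasses_of_isSmoothProjective hXP hX (μ hXP) (μ hX) (hμ hX) (fst A.X B.X) _ _
    (by omega) hc'alg

/-- **The cell `(g, p)` with `g = 2p + r` follows from the MIDDLE cell `(2(p+r), p+r)`, for motivated classes**: if on
every complex abelian variety of dimension `2(p+r)` the motivated classes of codimension `p + r` are algebraic, then
`A_motᵖ(A) ⊆ Nᵖ(A)` for every `A` of dimension `2p + r` (`r = 0`: the hypothesis; `r ≥ 1`: the product step with an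
abelian variety `B` of dimension `r`, `exists_abelianVariety_dim_eq_succ`, `AbelianVariety.dim_prod`).
[cite: BrosnanFangNiePearlstein2009, §6 Lemma 48] -/
theorem motivatedClasses_le_algebraicClasses_of_middleCell (A : AbelianVariety ℂ) {p r : ℕ} (hr : 2 * p + r = A.dim)
    (hmid : ∀ (B : AbelianVariety ℂ), B.dim = 2 * (p + r) →
      motivatedClasses B.dim B.X (p + r) ≤ algebraicClasses B.X (p + r)) :
    motivatedClasses A.dim A.X p ≤ algebraicClasses A.X p := by
  rcases r with _ | r'
  · have hA : A.dim = 2 * (p + 0) := by omega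
    have h := hmid A hA
    rw [hA]
    rwa [hA] at h
  · obtain ⟨B, hB⟩ := exists_abelianVariety_dim_eq_succ ℂ r'
    have hd : (A.prod B).dim = 2 * (p + (r' + 1)) := by rw [AbelianVariety.dim_prod, hB]; omega
    have h := hmid (A.prod B) hd
    rw [hd, AbelianVariety.prod_X] at h
    refine motivatedClasses_le_algebraicClasses_of_prod_middleDegree A B hr hB ?_
    rwa [show A.dim + (r' + 1) = 2 * (p + (r' + 1)) by omega]

/-- **ROW b05 IS THE MIDDLE DEGREE OF EVEN-DIMENSIONAL ABELIAN VARIETIES**: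
`MotivatedImpliesAlgebraicAV ⟺` on every complex abelian variety of even dimension `2m ≥ 4` the motivated classes of the
middle codimension `m` are algebraic (`A_motᵐ(A)_ℂ ⊆ Nᵐ H^{2m}(A(ℂ); ℂ)`). `⟸`: the lower half (§2) — a codimension
`2 ≤ p ≤ g/2` on `A` is the middle cell of `A × B`, `dim B = g - 2p` (§3 product step; motivated classes push forward
along the slice by §1 = André Prop. 2.1 (ii) + Corollaire, now theorems on the real carriers). Fact-free; row b05 is
NOT asserted; its grade «published modulo X» is unchanged. The motivated counterpart of ab-spread-1's
`HC_AV_iff_forall_middleDegree`. [cite: Andre1996Motifs, Thm. 0.6.2 (p. 9) and Prop. 2.1 (pp. 14–15)]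
[cite: BrosnanFangNiePearlstein2009, §6 Lemma 48] [cite: Lieberman1968, main theorem] -/
theorem motivatedImpliesAlgebraicAV_iff_forall_middleDegree :
    MotivatedImpliesAlgebraicAV ↔
      ∀ (A : AbelianVariety ℂ) (m : ℕ), 2 ≤ m → A.dim = 2 * m →
        motivatedClasses A.dim A.X m ≤ algebraicClasses A.X m := by
  refine ⟨fun h A m _ _ ↦ h A m, fun h ↦ motivatedImpliesAlgebraicAV_iff_lowerHalf.2 fun A p hp2 h2p ↦ ?_⟩
  obtain ⟨r, hr⟩ : ∃ r, 2 * p + r = A.dim := ⟨A.dim - 2 * p, by omega⟩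
  exact motivatedClasses_le_algebraicClasses_of_middleCell A hr fun B hB ↦ h B (p + r) (by omega) hB

/-- **A counterexample to row b05, if any, lives in the middle degree of an even-dimensional abelian variety**: the
contrapositive reading of `motivatedImpliesAlgebraicAV_iff_forall_middleDegree`. [cite: BrosnanFangNiePearlstein2009, §6 Lemma 48] -/
theorem not_motivatedImpliesAlgebraicAV_iff_exists_middleDegree :
    ¬ MotivatedImpliesAlgebraicAV ↔
      ∃ (A : AbelianVariety ℂ) (m : ℕ), 2 ≤ m ∧ A.dim = 2 * m ∧
        ¬ motivatedClasses A.dim A.X m ≤ algebraicClasses A.X m := by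
  rw [motivatedImpliesAlgebraicAV_iff_forall_middleDegree]
  push Not
  exact Iff.rfl

end Middle

end Summit.HodgeConjecture.HodgeConjecture.Ring2.Hypotheses

end
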